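import Literature.IUT.HodgeArakelov.AbsTopMonoidsGenuineGhatTorsionAction
import Literature.IUT.HodgeArakelov.AbsTopMonoidsGenuineGhatDensity
import HarnessLib

/-!
# [IUTchII] Remark 1.11.1 (i) (c) HOLDS at the GENUINE `(∗ĝp)`: the automorphisms of `G ↷ O^ĝp(G)` over `1 ∈ Aut(G)` are
# EXACTLY the `Ẑ^×`-powers — `Rmk1111_c (genuineOfModelIsm …) genuineGhat genuineGhatAct zhatPowOghat` PROVED

S. Mochizuki, *Inter-universal Teichmüller theory II*, §1, Remark 1.11.1 (i) (c), kurims manuscript (Dec. 2020) p. 50: "the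
group of automorphisms of the underlying ind-topological module equipped with a topological group action of `G ↷ O^ĝp(G)`
maps surjectively [i.e., by forgetting `O^ĝp(G)`] onto the group of automorphisms of the topological group `G`, with kernel
given by the [`G`-linear] automorphisms of [the underlying ind-topological module of] `O^ĝp(G)` determined by the natural
action of `Ẑ^×`" — "by the same proof involving the Kummer map as that given for (b) in [AbsTopIII], Proposition 3.3, (ii)"
[claim: Mochizuki2012, status: disputed] (IUTchII §1 Rmk 1.11.1 (i), kurims p.50).  abc-iut cell, layer L6, row
«GHATGP-GENUINE» STAGE 3d-β = THE CLOSER (seat abc-iut-L6-d2 gen 6; proof-only); nodes IUTchII:Rmk1.11.1(i) (clause (c), residual of abc-iut-w6-d010's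
coverage line) and IUTchII:Rmk1.11.3(ii) (clause (η), the `O^ĝp`-half).  In the `(∗ĝp) := (∗gp)` reading the kernel is
`{±1}` (abc-iut-w6-d016 p431190); at the GENUINE ind-profinite completion it is `Ẑ^×`, as printed:

* (prequel `AbsTopMonoidsGenuineGhatTorsionAction`: the `G_k`-action on normal levels, `N`-invariants of `O^ĝp` come
  from the level `N` — profinite Hilbert 90 in the direct limit —, `eq_one_of_forall_exists_invariant_pow`, and for an
  automorphism `ψ` of `O^ĝp` the unit `zhatOf ψ ∈ Ẑ^×` with `ψ = zhatPow (zhatOf ψ)` on the torsion `η(μ)`, `corrected ψ`);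
* abstract commutative-group identities `apply_mul_inv_eq_of_twist`, `apply_mul_inv_pow_of_pow_eq`,
  `apply_mul_inv_eq_of_fixed`, `apply_mul_inv_pow_of_eq_mul_pow` (so that the heavy direct-limit context sees one `exact`);
* **Kummer core** `apply_toOghat_eq_of_comm_of_torsion` (an equivariant automorphism fixing `η(μ)` fixes `η(k̄^×)`: `m`-th
  roots in `k̄` — `IsAlgClosed.exists_pow_nat_eq` — give `N`-invariant `m`-th roots of `φ(ηx)/ηx`, which therefore lies in
  the level `N` where `⋂_m (—)^m = 1`) and **`apply_eq_self_of_comm_of_torsion`** (extension to all of `O^ĝp` by DENSITY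
  `((k̄^×)^N)^∧ = η((k̄^×)^N)·(—)^m`, `level_density`);
* **`eq_zhatPowOghat_of_comm`**: an automorphism of `O^ĝp(G_k)` commuting with `G_k` is `x ↦ x^{u}`, `u = zhatOf ψ`; hence
  **`AbsTopMonoids.genuineGhat_kernel`** (CLAUSE (2)) and, with clauses (1)/(3) of
  `AbsTopMonoidsGenuineProfiniteGroupifications`, **`AbsTopMonoids.rmk1111_c_genuineGhat :
  Rmk1111_c (genuineOfModelIsm S C ε hΔ hq) (genuineGhat S C ε hΔ hq) (genuineGhatAct S C ε) (fun _ => zhatPowOghat C)`**.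

HONEST FRAMING: classical algebra / Kummer theory over OUR typed objects, every input PROVED in the tree; abc-iut-L6-t1's named
`Prop` `Rmk1111_c` is a SCHEMA over (A, Pg, actG, zhatPow) — here instantiated at the genuine data, no hypothesis beyond the
producer's (H1) `hΔ` / (H2) `hq`; ind-topologies not modelled (abstract automorphisms — a STRONGER statement); nothing here
bears on [IUTchIII] Cor. 3.12; typed ≠ proved elsewhere.
-/

set_option autoImplicit false

noncomputable section

namespace Literature.IUT.HodgeArakelov

open CategoryTheory
open Literature.AnabelianGeometry.AbsoluteAnabelian

namespace AbsTopMonoids.Genuine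

variable (C : MLFClosure.{0})

/-! ### Pure commutative-group identities behind the Kummer core (stated abstractly, so that the heavy
`O^ĝp = lim→ ((k̄^×)^J)^∧` context only ever sees one `exact`) -/

section Abstract

variable {U V X : Type*} [CommGroup U] [CommGroup V] [CommGroup X]

/-- If `g(ηy) = η(ξy)`, `φ` commutes with `g` at `ηy` and fixes `ηξ`, then `g` fixes the quotient `φ(ηy)·(ηy)⁻¹`.
[cite: NeukirchANT1999, Ch. IV §3 p.279] -/
theorem apply_mul_inv_eq_of_twist (η : U →* X) (g φ : X ≃* X) {y ξ : U} (hg : g (η y) = η (ξ * y))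
    (hc : φ (g (η y)) = g (φ (η y))) (ht : φ (η ξ) = η ξ) :
    g (φ (η y) * (η y)⁻¹) = φ (η y) * (η y)⁻¹ := by
  rw [map_mul, map_inv, ← hc, hg, map_mul η, map_mul φ, ht, mul_inv, mul_mul_mul_comm, mul_inv_cancel, one_mul]

/-- `(φ(ηy)·(ηy)⁻¹)^m = φ(ηx)·(ηx)⁻¹` when `y^m = x`. [cite: NeukirchANT1999, Ch. IV §3 p.279] -/
theorem apply_mul_inv_pow_of_pow_eq (η : U →* X) (φ : X ≃* X) {y x : U} {m : ℕ} (hy : y ^ m = x) :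
    (φ (η y) * (η y)⁻¹) ^ m = φ (η x) * (η x)⁻¹ := by
  rw [← hy, map_pow, map_pow, mul_pow, inv_pow]

/-- If `g v = v` and `φ` commutes with `g` at `v`, then `g` fixes `φ(v)·v⁻¹`. [cite: NeukirchANT1999, Ch. IV §3 p.279] -/
theorem apply_mul_inv_eq_of_fixed (g φ : X ≃* X) {v : X} (hg : g v = v) (hc : φ (g v) = g (φ v)) :
    g (φ v * v⁻¹) = φ v * v⁻¹ := by
  rw [map_mul, map_inv, ← hc, hg]

/-- `(φ(ιy)·(ιy)⁻¹)^m = φ(ιw)·(ιw)⁻¹` when `w = b·y^m` with `φ` fixing `ι b`. [cite: NeukirchANT1999, Ch. IV §3 p.279] -/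
theorem apply_mul_inv_pow_of_eq_mul_pow (ι : V →* X) (φ : X ≃* X) {w b y : V} {t : X} {m : ℕ}
    (hw : w = b * y ^ m) (hb : ι b = t) (ht : φ t = t) :
    (φ (ι y) * (ι y)⁻¹) ^ m = φ (ι w) * (ι w)⁻¹ := by
  rw [hw, map_mul, map_pow, hb, map_mul, map_pow, ht, mul_mul_inv_mul_inv, mul_inv_pow']

end Abstract

/-! ### The Kummer core: an equivariant automorphism fixing the torsion is the identity -/

section KummerCore

variable (φ : Oghat C ≃* Oghat C)
  (hφ : ∀ (σ : C.K ≃ₐ[C.k] C.K) (z : Oghat C), φ (galActOghat C σ z) = galActOghat C σ (φ z))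
  (hφt : ∀ (n : ℕ+) (ξ : (C.K)ˣ), ξ ^ (n : ℕ) = 1 → φ (toOghat C ξ) = toOghat C ξ)

include hφ hφt in
/-- **KUMMER STEP**: an equivariant `φ` fixing `η(μ(k̄))` fixes `η(k̄^×)` pointwise — for `x ∈ (k̄^×)^N` and `m ≥ 1`, an
`m`-th root `y ∈ k̄^×` of `x` gives the `N`-invariant `m`-th root `φ(η y)/η y` of `φ(η x)/η x` (the cocycle `σ ↦ σy/y` is
`μ_m`-valued, fixed by `φ`). [claim: Mochizuki2012, status: disputed] (IUTchII §1 Rmk 1.11.1 (i), kurims p.50) -/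
theorem apply_toOghat_eq_of_comm_of_torsion (x : (C.K)ˣ) : φ (toOghat C x) = toOghat C x := by
  obtain ⟨N, hNle, hNn⟩ := exists_openNormal_le C (levelOf C x).J
  haveI := hNn
  have hxN : ∀ σ : C.K ≃ₐ[C.k] C.K, σ ∈ (N : Subgroup (C.K ≃ₐ[C.k] C.K)) → σ (x : C.K) = x :=
    fun σ hσ => mem_fixedUnits_levelOf C x σ (hNle hσ)
  haveI : IsAlgClosed C.K := IsAlgClosure.isAlgClosed C.k
  have key : φ (toOghat C x) * (toOghat C x)⁻¹ = 1 := by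
    refine eq_one_of_forall_exists_invariant_pow C N _ fun m => ?_
    obtain ⟨y₀, hy₀⟩ := IsAlgClosed.exists_pow_nat_eq (x : C.K) m.pos
    have hy₀0 : y₀ ≠ 0 := by
      intro h; rw [h, zero_pow m.ne_zero] at hy₀; exact x.ne_zero hy₀.symm
    let y : (C.K)ˣ := Units.mk0 y₀ hy₀0
    have hy : y ^ (m : ℕ) = x := Units.ext (by rw [Units.val_pow_eq_pow_val, Units.val_mk0, hy₀])
    refine ⟨φ (toOghat C y) * (toOghat C y)⁻¹, fun σ hσ => ?_, apply_mul_inv_pow_of_pow_eq (toOghat C) φ hy⟩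
    -- `σ y = ξ · y` with `ξ := σ(y) y⁻¹`, `ξ^m = σ(x) x⁻¹ = 1`
    have hξm : (galUnitsEquiv C σ y * y⁻¹) ^ (m : ℕ) = 1 := by
      rw [mul_pow, inv_pow, ← map_pow (galUnitsEquiv C σ), hy]
      exact mul_inv_eq_one.mpr (Units.ext (hxN σ hσ))
    exact apply_mul_inv_eq_of_twist (toOghat C) (galActOghat C σ) φ
      (by rw [galActOghat_toOghat, inv_mul_cancel_right]) (hφ σ _) (hφt m _ hξm)
  exact mul_inv_eq_one.mp key

include hφ hφt in
/-- **An equivariant automorphism of `O^ĝp` fixing the torsion is the IDENTITY** (density of `η((k̄^×)^N)` in the level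
`N` modulo `m`-th powers, for every `m`). [claim: Mochizuki2012, status: disputed] (IUTchII §1 Rmk 1.11.1 (i), kurims p.50) -/
theorem apply_eq_self_of_comm_of_torsion (z : Oghat C) : φ z = z := by
  induction z using DirectLimit.induction with
  | ih i w =>
    obtain ⟨N, hNle, hNn⟩ := exists_openNormal_le C i.J
    haveI := hNn
    have hiN : i ≤ (⟨N⟩ : GhatLevel C) := fun τ hτ => hNle hτ
    rw [← ofLevel_apply, ← ofLevel_levelMap C hiN]
    have key : φ (ofLevel C ⟨N⟩ (levelMap C i ⟨N⟩ hiN w)) * (ofLevel C ⟨N⟩ (levelMap C i ⟨N⟩ hiN w))⁻¹ = 1 := by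
      refine eq_one_of_forall_exists_invariant_pow C N _ fun m => ?_
      obtain ⟨a, y, hw'⟩ := level_density C N m (levelMap C i ⟨N⟩ hiN w)
      exact ⟨φ (ofLevel C ⟨N⟩ y) * (ofLevel C ⟨N⟩ y)⁻¹,
        fun σ hσ => apply_mul_inv_eq_of_fixed (galActOghat C σ) φ (galActOghat_ofLevel_of_mem C N σ hσ y) (hφ σ _),
        apply_mul_inv_pow_of_eq_mul_pow (ofLevel C ⟨N⟩) φ hw' (ofLevel_of C ⟨N⟩ a)
          (apply_toOghat_eq_of_comm_of_torsion C φ hφ hφt (a : (C.K)ˣ))⟩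
    exact mul_inv_eq_one.mp key

end KummerCore

section Kernel

variable (ψ : Oghat C ≃* Oghat C)
  (hψ : ∀ (σ : C.K ≃ₐ[C.k] C.K) (z : Oghat C), ψ (galActOghat C σ z) = galActOghat C σ (ψ z))

include hψ in
/-- **[AbsTopIII] Prop. 3.3 (ii) for the genuine `(∗ĝp)`**: an automorphism of `O^ĝp(G_k)` commuting with the
`G_k`-action is a `Ẑ^×`-power. [claim: Mochizuki2012, status: disputed] (IUTchII §1 Rmk 1.11.1 (i), kurims p.50) -/
theorem eq_zhatPowOghat_of_comm : ψ = zhatPowOghat C (zhatOf C ψ) := by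
  apply MulEquiv.ext
  intro z
  have h := apply_eq_self_of_comm_of_torsion C (corrected C ψ) (corrected_comm C ψ hψ)
    (fun n ξ hξ => corrected_toOghat_torsion C ψ ξ hξ) z
  rw [corrected_apply, MulEquiv.symm_apply_eq] at h
  exact h

end Kernel

end AbsTopMonoids.Genuine

/-! ## Remark 1.11.1 (i) (c) at the genuine `(∗ĝp)` — all three clauses -/

section Rmk1111c

open AbsTopMonoids AbsTopMonoids.Genuine

variable (S : ThetaSetting.{0}) (C : MLFClosure.{0}) (ε : S.Gk ≃ₜ* (ModelMLFGaloisData.galois C.k C.K).tmPair.Pi)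
  (hΔ : ∀ f : S.PiX ≃ₜ* S.PiX, S.DeltaX.map f.toMulEquiv.toMonoidHom = S.DeltaX)
  (hq : Nonempty (TopGroup.quot S.PiX S.DeltaX ≃ₜ* S.Gk))

/-- **IUTchII:Rmk1.11.1(i) (c), SECOND CLAUSE (the kernel), at the genuine `(∗ĝp)`**: an automorphism of the pair
`G ↷ O^ĝp(G)` over `1 ∈ Aut(G)` is a `Ẑ^×`-power. [claim: Mochizuki2012, status: disputed] (IUTchII §1 Rmk 1.11.1 (i), kurims p.50) -/
theorem AbsTopMonoids.genuineGhat_kernel (G : IsoClass S.Gk)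
    (p : PairAut G ((AbsTopMonoids.genuineGhat S C ε hΔ hq).Oghat G) (AbsTopMonoids.genuineGhatAct S C ε G))
    (hp : PairAut.forget p = 1) : ∃ u : ZHatUnits, p.1.2 = zhatPowOghat C u := by
  have hp1 : p.1.1 = 1 := hp
  have hcomm : ∀ (σ : C.K ≃ₐ[C.k] C.K) (z : Genuine.Oghat C),
      p.1.2 (galActOghat C σ z) = galActOghat C σ (p.1.2 z) := by
    intro σ z
    have h := p.2 ((theta C ε G).symm σ) z
    rw [hp1] at h
    change p.1.2 (galActOghat C (theta C ε G ((theta C ε G).symm σ)) z) =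
      galActOghat C (theta C ε G ((theta C ε G).symm σ)) (p.1.2 z) at h
    rwa [ContinuousMulEquiv.apply_symm_apply] at h
  exact ⟨zhatOf C p.1.2, eq_zhatPowOghat_of_comm C p.1.2 hcomm⟩

/-- **IUTchII:Rmk1.11.1(i) (c) HOLDS at the genuine `(∗ĝp)` over the all-fields-genuine producer**: the group of automorphisms
of `G ↷ O^ĝp(G)` maps SURJECTIVELY onto `Aut(G)` with KERNEL exactly the `Ẑ^×`-powers (which are `G`-linear) —
abc-iut-L6-t1's named `Prop` `Rmk1111_c`, at `genuineOfModelIsm` with `Pg := genuineGhat`, the genuine `G`-action and the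
natural `Ẑ^×`-action. [claim: Mochizuki2012, status: disputed] (IUTchII §1 Rmk 1.11.1 (i), kurims p.50) -/
theorem AbsTopMonoids.rmk1111_c_genuineGhat :
    Rmk1111_c (AbsTopMonoids.genuineOfModelIsm S C ε hΔ hq) (AbsTopMonoids.genuineGhat S C ε hΔ hq)
      (AbsTopMonoids.genuineGhatAct S C ε) (fun _ => zhatPowOghat C) := fun G =>
  ⟨AbsTopMonoids.genuineGhat_forget_surjective S C ε hΔ hq G,
    fun p hp => AbsTopMonoids.genuineGhat_kernel S C ε hΔ hq G p hp,
    fun u => AbsTopMonoids.genuineGhat_zhatPow_mem_pairAut S C ε hΔ hq G u⟩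

end Rmk1111c


end Literature.IUT.HodgeArakelov

end
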